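import Mathlib
import Summits.NavierStokesRegularity.NavierStokesRegularity.Theorems.EulerZoomLiouvilleSereginZoomReductionPairingPrimitive
import HarnessLib

/-!
# Weak equicontinuity in time of the velocity pairings, UNIFORMLY IN THE VISCOSITY `|ν| ≤ 1` —
# part 2: the remainder bound and the modulus (support item `EulerZoomLiouville.SereginZoomReduction` = stmt-19834)

Route `EulerZoomLiouville` (NavierStokesRegularity), support item Z = Seregin's Euler-zoom theorem (Seregin 2026
Thm 3.1 = Seregin 2023 Prop 1.2 at `(s,l,κ) = (3,3,2)`, `f(r) = r^ρ`): a compactness argument for the zoomed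
sequence `v_k(s,y) = λ_k^{1+ρ} v(t₀ + λ_k^{2+ρ}s, x₀ + λ_k y)`, which solves Navier–Stokes with the VANISHING
viscosities `ν_k = λ_k^ρ → 0`.  The tree's equicontinuity input of the velocity compactness on a cylinder,
`NSCylinder.exists_fullMeasure_pairing_modulus` (Lin 1998 Thm 2.2 / Bradshaw–Tsai 2019 §4.3), is stated for
`ν = 1`; this file is its `ν`-uniform twin (same proof with `ν` threaded through; for `|ν| ≤ 1` the modulus is
the `ν = 1` one): `setIntegral_deriv_mul_pairing_add_eq_zero_visc` / `exists_ae_pairing_eq_const_add_primitive_visc`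
(the pairing `∫_Ω ⟪u(t), η⟫` is a.e. the primitive of `∫_Ω (⟪u, Dη u⟫ + ν⟪u, Δη⟫ + p div η)`),
`ae_abs_remainder_le_visc` (the remainder bound), `exists_fullMeasure_pairing_modulus_visc` (the modulus
`A|t-s| + B|t-s|^{1/3}` on a full-measure set of times, `A = K₁C + K₂(|Ω| + C)`, `B = 3K₁(|Ω|^{1/2}C_p)^{2/3}`).
WHAT THIS IS NOT: not NS regularity, not the crux; bookkeeping toward the kernel proof of the support item Z
(`--supports` stmt-19834). [folklore]
-/

noncomputable section

set_option linter.dupNamespace false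

open MeasureTheory TopologicalSpace Set Function Filter Topology Metric Bornology intervalIntegral
open scoped NNReal ENNReal InnerProductSpace RealInnerProductSpace Laplacian

namespace Summit.NavierStokesRegularity.NavierStokesRegularity.Theorems.SereginZoomReduction

open Literature.Analysis Literature.Analysis.FluidPDE Literature.Analysis.FunctionSpaces

/-! ### The remainder bound and the modulus, uniformly in `|ν| ≤ 1` -/

section Modulus

variable {u : ℝ → (EuclideanSpace ℝ (Fin 3)) → (EuclideanSpace ℝ (Fin 3))}
  {p : ℝ → (EuclideanSpace ℝ (Fin 3)) → ℝ} {Ω : Opens (EuclideanSpace ℝ (Fin 3))} {a b ν : ℝ}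

/-- The `3 K₁` bound on the divergence of a field with `‖Dη‖ ≤ K₁`. [folklore] -/
theorem norm_divergence_le_three_mul {η : (EuclideanSpace ℝ (Fin 3)) → (EuclideanSpace ℝ (Fin 3))}
    {K₁ : ℝ} (hK₁ : ∀ x, ‖fderiv ℝ η x‖ ≤ K₁) (x : (EuclideanSpace ℝ (Fin 3))) :
    ‖VectorCalculus.divergence η x‖ ≤ 3 * K₁ := by
  set bb := EuclideanSpace.basisFun (Fin 3) ℝ
  rw [divergence_eq_sum_inner_fderiv bb η x, Real.norm_eq_abs]
  calc |∑ i, ⟪bb i, fderiv ℝ η x (bb i)⟫|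
      ≤ ∑ i, |⟪bb i, fderiv ℝ η x (bb i)⟫| := Finset.abs_sum_le_sum_abs _ _
    _ ≤ ∑ _i : Fin 3, K₁ := Finset.sum_le_sum fun i _ => ?_
    _ = 3 * K₁ := by simp
  calc |⟪bb i, fderiv ℝ η x (bb i)⟫| ≤ ‖bb i‖ * ‖fderiv ℝ η x (bb i)‖ := abs_real_inner_le_norm _ _
    _ ≤ 1 * (‖fderiv ℝ η x‖ * 1) := by
        rw [bb.norm_eq_one i]
        gcongr
        simpa [bb.norm_eq_one i] using (fderiv ℝ η x).le_opNorm (bb i)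
    _ ≤ K₁ := by simpa using hK₁ x

/-- **The viscosity-`ν` remainder is bounded by the energy and the pressure slice, a.e. in time**
(`|ν| ≤ 1`): with `∫_Ω ‖u(t)‖² ≤ C` for a.e. `t`, `p ∈ L¹(W)`, `‖Dη‖ ≤ K₁`, `‖Δη‖ ≤ K₂`,
`|∫_Ω (⟪u, Dη u⟫ + ν⟪u, Δη⟫ + p div η)(t)| ≤ K₁ C + K₂ (|Ω| + C) + 3 K₁ ∫_Ω |p(t)|` for a.e. `t`.
[folklore] -/
theorem ae_abs_remainder_le_visc (hν : |ν| ≤ 1) (hbΩ : IsBounded (Ω : Set (EuclideanSpace ℝ (Fin 3))))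
    (hm : AEStronglyMeasurable (uncurry u) (volume.restrict (Ioo a b ×ˢ (Ω : Set (EuclideanSpace ℝ (Fin 3))))))
    {C : ℝ≥0∞} (hC : C ≠ ⊤)
    (hE : ∀ᵐ t ∂(volume.restrict (Ioo a b)), ∫⁻ x in (Ω : Set (EuclideanSpace ℝ (Fin 3))), ‖u t x‖ₑ ^ 2 ≤ C)
    (hpi : Integrable (uncurry p) (volume.restrict (Ioo a b ×ˢ (Ω : Set (EuclideanSpace ℝ (Fin 3))))))
    {η : (EuclideanSpace ℝ (Fin 3)) → (EuclideanSpace ℝ (Fin 3))} (hη2 : ContDiff ℝ 2 η) {K₁ K₂ : ℝ}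
    (hK₁ : ∀ x, ‖fderiv ℝ η x‖ ≤ K₁) (hK₂ : ∀ x, ‖Δ η x‖ ≤ K₂) :
    ∀ᵐ t ∂(volume.restrict (Ioo a b)),
      |∫ x in (Ω : Set (EuclideanSpace ℝ (Fin 3))), (⟪u t x, fderiv ℝ η x (u t x)⟫ + ν * ⟪u t x, Δ η x⟫ +
          p t x * VectorCalculus.divergence η x)| ≤
        K₁ * C.toReal + K₂ * ((volume (Ω : Set (EuclideanSpace ℝ (Fin 3)))).toReal + C.toReal) +
          3 * K₁ * ∫ x in (Ω : Set (EuclideanSpace ℝ (Fin 3))), |p t x| := by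
  haveI : IsFiniteMeasure ((volume : Measure (EuclideanSpace ℝ (Fin 3))).restrict
      (Ω : Set (EuclideanSpace ℝ (Fin 3)))) := ⟨by
    rw [Measure.restrict_apply_univ]
    exact (measure_mono subset_closure).trans_lt hbΩ.isCompact_closure.measure_lt_top⟩
  have hdivb : ∀ x, ‖VectorCalculus.divergence η x‖ ≤ 3 * K₁ := norm_divergence_le_three_mul hK₁
  have cD : Continuous (fderiv ℝ η) := hη2.continuous_fderiv (by simp)
  have hK₁0 : 0 ≤ K₁ := (norm_nonneg _).trans (hK₁ 0)
  have hK₂0 : 0 ≤ K₂ := (norm_nonneg _).trans (hK₂ 0)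
  have hpi' := hpi
  rw [FunctionSpaces.AubinLions.volume_restrict_prod] at hpi'
  filter_upwards [hE, FunctionSpaces.AubinLions.ae_aestronglyMeasurable_slice hm, hpi'.prod_right_ae]
    with t hEt hut hpt
  have hpt' : Integrable (fun x => p t x) (volume.restrict (Ω : Set (EuclideanSpace ℝ (Fin 3)))) := hpt
  have hmu : MemLp (u t) 2 (volume.restrict (Ω : Set (EuclideanSpace ℝ (Fin 3)))) :=
    NSCylinder.memLp_two_slice hC hut hEt
  have hiu : Integrable (u t) (volume.restrict (Ω : Set (EuclideanSpace ℝ (Fin 3)))) :=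
    memLp_one_iff_integrable.1 (hmu.mono_exponent one_le_two)
  have hiu2 : Integrable (fun x => ‖u t x‖ ^ 2) (volume.restrict (Ω : Set (EuclideanSpace ℝ (Fin 3)))) := by
    have h := hmu.integrable_norm_rpow two_ne_zero ENNReal.ofNat_ne_top
    refine h.congr (Eventually.of_forall fun x => ?_)
    simp only [ENNReal.toReal_ofNat, Real.rpow_two]
  have hE' : ∫ x in (Ω : Set (EuclideanSpace ℝ (Fin 3))), ‖u t x‖ ^ 2 ≤ C.toReal :=
    NSCylinder.integral_norm_sq_le_toReal hC hut hEt
  -- the three pieces and their integrability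
  have i1 : Integrable (fun x => ⟪u t x, fderiv ℝ η x (u t x)⟫)
      (volume.restrict (Ω : Set (EuclideanSpace ℝ (Fin 3)))) := by
    have hm1 : AEStronglyMeasurable (fun x => ⟪u t x, fderiv ℝ η x (u t x)⟫)
        (volume.restrict (Ω : Set (EuclideanSpace ℝ (Fin 3)))) :=
      hut.inner (isBoundedBilinearMap_apply.continuous.comp_aestronglyMeasurable
        (cD.aestronglyMeasurable.prodMk hut))
    refine Integrable.mono' (hiu2.const_mul K₁) hm1 (Eventually.of_forall fun x => ?_)
    calc ‖⟪u t x, fderiv ℝ η x (u t x)⟫‖ ≤ ‖u t x‖ * ‖fderiv ℝ η x (u t x)‖ := norm_inner_le_norm _ _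
      _ ≤ ‖u t x‖ * (K₁ * ‖u t x‖) := by
          gcongr
          exact (ContinuousLinearMap.le_opNorm _ _).trans
            (mul_le_mul_of_nonneg_right (hK₁ x) (norm_nonneg _))
      _ = K₁ * ‖u t x‖ ^ 2 := by ring
  have i2 : Integrable (fun x => ν * ⟪u t x, Δ η x⟫) (volume.restrict (Ω : Set (EuclideanSpace ℝ (Fin 3)))) := by
    refine Integrable.const_mul ?_ ν
    refine Integrable.mono' (hiu.norm.mul_const K₂)
      (hut.inner (continuous_laplacian hη2).aestronglyMeasurable) (Eventually.of_forall fun x => ?_)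
    exact (norm_inner_le_norm _ _).trans (mul_le_mul_of_nonneg_left (hK₂ x) (norm_nonneg _))
  have i3 : Integrable (fun x => p t x * VectorCalculus.divergence η x)
      (volume.restrict (Ω : Set (EuclideanSpace ℝ (Fin 3)))) := by
    have : (fun x => p t x * VectorCalculus.divergence η x) =
        fun x => VectorCalculus.divergence η x * p t x := by ext x; ring
    rw [this]
    exact hpt'.bdd_mul (continuous_divergence cD).aestronglyMeasurable
      (Eventually.of_forall fun x => hdivb x)
  -- the three bounds
  have b1 : ∫ x in (Ω : Set (EuclideanSpace ℝ (Fin 3))), ‖⟪u t x, fderiv ℝ η x (u t x)⟫‖ ≤ K₁ * C.toReal := by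
    calc ∫ x in (Ω : Set (EuclideanSpace ℝ (Fin 3))), ‖⟪u t x, fderiv ℝ η x (u t x)⟫‖
        ≤ ∫ x in (Ω : Set (EuclideanSpace ℝ (Fin 3))), K₁ * ‖u t x‖ ^ 2 := by
          refine integral_mono i1.norm (hiu2.const_mul K₁) fun x => ?_
          calc ‖⟪u t x, fderiv ℝ η x (u t x)⟫‖ ≤ ‖u t x‖ * ‖fderiv ℝ η x (u t x)‖ :=
                norm_inner_le_norm _ _
            _ ≤ ‖u t x‖ * (K₁ * ‖u t x‖) := by
                gcongr
                exact (ContinuousLinearMap.le_opNorm _ _).trans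
                  (mul_le_mul_of_nonneg_right (hK₁ x) (norm_nonneg _))
            _ = K₁ * ‖u t x‖ ^ 2 := by ring
      _ = K₁ * ∫ x in (Ω : Set (EuclideanSpace ℝ (Fin 3))), ‖u t x‖ ^ 2 :=
          MeasureTheory.integral_const_mul _ _
      _ ≤ K₁ * C.toReal := mul_le_mul_of_nonneg_left hE' hK₁0
  have b2 : ∫ x in (Ω : Set (EuclideanSpace ℝ (Fin 3))), ‖ν * ⟪u t x, Δ η x⟫‖ ≤
      K₂ * ((volume (Ω : Set (EuclideanSpace ℝ (Fin 3)))).toReal + C.toReal) := by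
    calc ∫ x in (Ω : Set (EuclideanSpace ℝ (Fin 3))), ‖ν * ⟪u t x, Δ η x⟫‖
        ≤ ∫ x in (Ω : Set (EuclideanSpace ℝ (Fin 3))), K₂ * (1 + ‖u t x‖ ^ 2) := by
          refine integral_mono i2.norm (((integrable_const _).add hiu2).const_mul K₂) fun x => ?_
          calc ‖ν * ⟪u t x, Δ η x⟫‖ = |ν| * ‖⟪u t x, Δ η x⟫‖ := by
                rw [norm_mul, Real.norm_eq_abs]
            _ ≤ 1 * ‖⟪u t x, Δ η x⟫‖ := mul_le_mul_of_nonneg_right hν (norm_nonneg _)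
            _ = ‖⟪u t x, Δ η x⟫‖ := one_mul _
            _ ≤ ‖u t x‖ * ‖Δ η x‖ := norm_inner_le_norm _ _
            _ ≤ (1 + ‖u t x‖ ^ 2) * K₂ :=
                mul_le_mul (NSCylinder.norm_le_one_add_sq _) (hK₂ x) (norm_nonneg _) (by positivity)
            _ = K₂ * (1 + ‖u t x‖ ^ 2) := mul_comm _ _
      _ = K₂ * ((volume (Ω : Set (EuclideanSpace ℝ (Fin 3)))).toReal +
            ∫ x in (Ω : Set (EuclideanSpace ℝ (Fin 3))), ‖u t x‖ ^ 2) := by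
          rw [MeasureTheory.integral_const_mul, integral_add (integrable_const _) hiu2,
            MeasureTheory.integral_const, measureReal_restrict_apply_univ, smul_eq_mul, mul_one,
            measureReal_def]
      _ ≤ K₂ * ((volume (Ω : Set (EuclideanSpace ℝ (Fin 3)))).toReal + C.toReal) := by gcongr
  have b3 : ∫ x in (Ω : Set (EuclideanSpace ℝ (Fin 3))), ‖p t x * VectorCalculus.divergence η x‖ ≤
      3 * K₁ * ∫ x in (Ω : Set (EuclideanSpace ℝ (Fin 3))), |p t x| := by
    calc ∫ x in (Ω : Set (EuclideanSpace ℝ (Fin 3))), ‖p t x * VectorCalculus.divergence η x‖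
        ≤ ∫ x in (Ω : Set (EuclideanSpace ℝ (Fin 3))), 3 * K₁ * |p t x| := by
          refine integral_mono i3.norm (hpt'.abs.const_mul _) fun x => ?_
          rw [norm_mul, Real.norm_eq_abs, mul_comm (3 * K₁)]
          exact mul_le_mul_of_nonneg_left (hdivb x) (abs_nonneg _)
      _ = 3 * K₁ * ∫ x in (Ω : Set (EuclideanSpace ℝ (Fin 3))), |p t x| :=
          MeasureTheory.integral_const_mul _ _
  -- assemble
  calc |∫ x in (Ω : Set (EuclideanSpace ℝ (Fin 3))), (⟪u t x, fderiv ℝ η x (u t x)⟫ + ν * ⟪u t x, Δ η x⟫ +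
          p t x * VectorCalculus.divergence η x)|
      ≤ ∫ x in (Ω : Set (EuclideanSpace ℝ (Fin 3))), ‖⟪u t x, fderiv ℝ η x (u t x)⟫ + ν * ⟪u t x, Δ η x⟫ +
          p t x * VectorCalculus.divergence η x‖ := by
        rw [← Real.norm_eq_abs]; exact norm_integral_le_integral_norm _
    _ ≤ ∫ x in (Ω : Set (EuclideanSpace ℝ (Fin 3))), (‖⟪u t x, fderiv ℝ η x (u t x)⟫‖ + ‖ν * ⟪u t x, Δ η x⟫‖ +
          ‖p t x * VectorCalculus.divergence η x‖) :=
        integral_mono ((i1.add i2).add i3).norm ((i1.norm.add i2.norm).add i3.norm) fun x =>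
          (norm_add_le _ _).trans (add_le_add (norm_add_le _ _) le_rfl)
    _ = (∫ x in (Ω : Set (EuclideanSpace ℝ (Fin 3))), ‖⟪u t x, fderiv ℝ η x (u t x)⟫‖) +
          (∫ x in (Ω : Set (EuclideanSpace ℝ (Fin 3))), ‖ν * ⟪u t x, Δ η x⟫‖) +
          ∫ x in (Ω : Set (EuclideanSpace ℝ (Fin 3))), ‖p t x * VectorCalculus.divergence η x‖ := by
        have i12 : Integrable (fun x => ‖⟪u t x, fderiv ℝ η x (u t x)⟫‖ + ‖ν * ⟪u t x, Δ η x⟫‖)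
            (volume.restrict (Ω : Set (EuclideanSpace ℝ (Fin 3)))) := i1.norm.add i2.norm
        rw [integral_add i12 i3.norm, integral_add i1.norm i2.norm]
    _ ≤ K₁ * C.toReal + K₂ * ((volume (Ω : Set (EuclideanSpace ℝ (Fin 3)))).toReal + C.toReal) +
          3 * K₁ * ∫ x in (Ω : Set (EuclideanSpace ℝ (Fin 3))), |p t x| :=
        add_le_add (add_le_add b1 b2) b3

/-- **Modulus of continuity of the pairings, up to a null set of times, uniformly in `|ν| ≤ 1`.**
Let `(u, p)` be a distributional solution of Navier–Stokes with viscosity `ν`, `|ν| ≤ 1`, no force,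
in `W = (a, b) × Ω`, `Ω` bounded, with `∫_Ω ‖u(t)‖² ≤ C` for a.e. `t` and `∫∫_W |p|^{3/2} ≤ C_p`, and let
`η` be a test field on `Ω` with `‖Dη‖ ≤ K₁`, `‖Δη‖ ≤ K₂`.  Then on a full-measure set `S ⊆ (a, b)`,
`|∫_Ω ⟪u(t), η⟫ - ∫_Ω ⟪u(s), η⟫| ≤ A |t - s| + B |t - s|^{1/3}` for `t, s ∈ S`, with the `ν = 1`
constants `A = K₁ C + K₂ (|Ω| + C)`, `B = 3 K₁ (|Ω|^{1/2} C_p)^{2/3}` of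
`NSCylinder.exists_fullMeasure_pairing_modulus`. [folklore] -/
theorem exists_fullMeasure_pairing_modulus_visc (hν : |ν| ≤ 1)
    (hsol : IsDistributionalNSSolutionOn (timeCylinder Ω a b) ν 0 u p)
    (hbΩ : IsBounded (Ω : Set (EuclideanSpace ℝ (Fin 3)))) {C Cp : ℝ≥0∞} (hC : C ≠ ⊤) (hCp : Cp ≠ ⊤)
    (hE : ∀ᵐ t ∂(volume.restrict (Ioo a b)), ∫⁻ x in (Ω : Set (EuclideanSpace ℝ (Fin 3))), ‖u t x‖ₑ ^ 2 ≤ C)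
    (hP : ∫⁻ z in Ioo a b ×ˢ (Ω : Set (EuclideanSpace ℝ (Fin 3))), ‖p z.1 z.2‖ₑ ^ (3 / 2 : ℝ) ≤ Cp)
    {η : (EuclideanSpace ℝ (Fin 3)) → (EuclideanSpace ℝ (Fin 3))} (hη : FunctionSpaces.IsTestFunctionOn Ω η) {K₁ K₂ : ℝ}
    (hK₁ : ∀ x, ‖fderiv ℝ η x‖ ≤ K₁) (hK₂ : ∀ x, ‖Δ η x‖ ≤ K₂) :
    ∃ S : Set ℝ, (∀ᵐ t ∂(volume.restrict (Ioo a b)), t ∈ S) ∧ ∀ t ∈ S, ∀ s ∈ S,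
      |(∫ x in (Ω : Set (EuclideanSpace ℝ (Fin 3))), ⟪u t x, η x⟫) -
          ∫ x in (Ω : Set (EuclideanSpace ℝ (Fin 3))), ⟪u s x, η x⟫| ≤
        (K₁ * C.toReal + K₂ * ((volume (Ω : Set (EuclideanSpace ℝ (Fin 3)))).toReal + C.toReal)) * |t - s| +
          3 * K₁ * (((volume (Ω : Set (EuclideanSpace ℝ (Fin 3)))) ^ (1 / 2 : ℝ) * Cp) ^ (2 / 3 : ℝ)).toReal *
            |t - s| ^ (1 / 3 : ℝ) := by
  have hm : AEStronglyMeasurable (uncurry u) (volume.restrict (Ioo a b ×ˢ (Ω : Set (EuclideanSpace ℝ (Fin 3))))) :=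
    hsol.1.aestronglyMeasurable
  have hpm : AEStronglyMeasurable (uncurry p) (volume.restrict (Ioo a b ×ˢ (Ω : Set (EuclideanSpace ℝ (Fin 3))))) :=
    hsol.2.2.1.aestronglyMeasurable
  -- `u ∈ L²(W)` and `p ∈ L¹(W)`
  have hu2 : ∫⁻ z in Ioo a b ×ˢ (Ω : Set (EuclideanSpace ℝ (Fin 3))), ‖u z.1 z.2‖ₑ ^ 2 < ∞ := by
    have h := FunctionSpaces.AubinLions.lintegral_sq_eq_lintegral_slice hm
    calc ∫⁻ z in Ioo a b ×ˢ (Ω : Set (EuclideanSpace ℝ (Fin 3))), ‖u z.1 z.2‖ₑ ^ 2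
        = ∫⁻ t in Ioo a b, ∫⁻ x in (Ω : Set (EuclideanSpace ℝ (Fin 3))), ‖u t x‖ₑ ^ 2 := h
      _ ≤ ∫⁻ _ in Ioo a b, C := lintegral_mono_ae hE
      _ < ∞ := by
          rw [lintegral_const, Measure.restrict_apply_univ]
          exact ENNReal.mul_lt_top hC.lt_top measure_Ioo_lt_top
  have hPfin : ∫⁻ z in Ioo a b ×ˢ (Ω : Set (EuclideanSpace ℝ (Fin 3))), ‖p z.1 z.2‖ₑ ^ (3 / 2 : ℝ) < ∞ :=
    hP.trans_lt hCp.lt_top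
  have hpi := NSCylinder.integrable_pressure_of_lintegral_rpow hbΩ hpm hPfin
  -- the primitive representation and the remainder
  obtain ⟨c, hc⟩ := exists_ae_pairing_eq_const_add_primitive_visc hsol hbΩ hu2 hpi hη
  have hη2 : ContDiff ℝ 2 η := hη.contDiff.of_le (by norm_cast)
  have hu := NSCylinder.integrable_of_lintegral_sq hbΩ hm hu2
  have hu2' := NSCylinder.integrable_norm_sq_of_lintegral_sq hm hu2
  have iG := integrable_remainder_test_visc ν hu hu2' hpi hη2 hK₁ hK₂
  have hpi' := hpi
  rw [FunctionSpaces.AubinLions.volume_restrict_prod] at iG hpi'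
  have hFi : IntegrableOn (fun τ => ∫ x in (Ω : Set (EuclideanSpace ℝ (Fin 3))), (⟪u τ x, fderiv ℝ η x (u τ x)⟫ +
      ν * ⟪u τ x, Δ η x⟫ + p τ x * VectorCalculus.divergence η x)) (Ioo a b) volume :=
    iG.integral_prod_left
  have hqi : IntegrableOn (fun τ => ∫ x in (Ω : Set (EuclideanSpace ℝ (Fin 3))), |p τ x|) (Ioo a b) volume := by
    have h := hpi'.integral_norm_prod_left
    simp only [Real.norm_eq_abs, Function.uncurry_apply_pair] at h
    exact h
  have hR := ae_abs_remainder_le_visc hν hbΩ hm hC hE hpi hη2 hK₁ hK₂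
  -- abbreviations for the constants
  set A : ℝ := K₁ * C.toReal + K₂ * ((volume (Ω : Set (EuclideanSpace ℝ (Fin 3)))).toReal + C.toReal) with hA
  set B : ℝ := (((volume (Ω : Set (EuclideanSpace ℝ (Fin 3)))) ^ (1 / 2 : ℝ) * Cp) ^ (2 / 3 : ℝ)).toReal with hB
  have hK₁0 : 0 ≤ K₁ := (norm_nonneg _).trans (hK₁ 0)
  have hB0 : 0 ≤ B := ENNReal.toReal_nonneg
  -- the good set
  refine ⟨{t | t ∈ Ioo a b ∧ (∫ x in (Ω : Set (EuclideanSpace ℝ (Fin 3))), ⟪u t x, η x⟫) = c + ∫ s in Ioc a t,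
      ∫ x in (Ω : Set (EuclideanSpace ℝ (Fin 3))), (⟪u s x, fderiv ℝ η x (u s x)⟫ + ν * ⟪u s x, Δ η x⟫ +
        p s x * VectorCalculus.divergence η x)}, ?_, ?_⟩
  · filter_upwards [ae_restrict_mem measurableSet_Ioo, hc] with t ht htc
    exact ⟨ht, htc⟩
  -- the increment bound for `s ≤ t`
  have key : ∀ t ∈ Ioo a b, ∀ s ∈ Ioo a b, s ≤ t →
      |(∫ τ in Ioc a t, ∫ x in (Ω : Set (EuclideanSpace ℝ (Fin 3))), (⟪u τ x, fderiv ℝ η x (u τ x)⟫ +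
          ν * ⟪u τ x, Δ η x⟫ + p τ x * VectorCalculus.divergence η x)) -
        ∫ τ in Ioc a s, ∫ x in (Ω : Set (EuclideanSpace ℝ (Fin 3))), (⟪u τ x, fderiv ℝ η x (u τ x)⟫ +
          ν * ⟪u τ x, Δ η x⟫ + p τ x * VectorCalculus.divergence η x)| ≤
        A * (t - s) + 3 * K₁ * B * (t - s) ^ (1 / 3 : ℝ) := by
    intro t ht s hs hst
    have hsub_st : Ioc s t ⊆ Ioo a b := fun x hx => ⟨hs.1.trans hx.1, hx.2.trans_lt ht.2⟩
    have hunion : Ioc a t = Ioc a s ∪ Ioc s t := (Ioc_union_Ioc_eq_Ioc hs.1.le hst).symm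
    have hdisj : Disjoint (Ioc a s) (Ioc s t) := Ioc_disjoint_Ioc_of_le le_rfl
    rw [hunion, setIntegral_union hdisj measurableSet_Ioc
      (hFi.mono_set (fun x hx => ⟨hx.1, hx.2.trans_lt hs.2⟩)) (hFi.mono_set hsub_st)]
    simp only [add_sub_cancel_left]
    calc |∫ τ in Ioc s t, ∫ x in (Ω : Set (EuclideanSpace ℝ (Fin 3))), (⟪u τ x, fderiv ℝ η x (u τ x)⟫ +
            ν * ⟪u τ x, Δ η x⟫ + p τ x * VectorCalculus.divergence η x)|
        ≤ ∫ τ in Ioc s t, |∫ x in (Ω : Set (EuclideanSpace ℝ (Fin 3))), (⟪u τ x, fderiv ℝ η x (u τ x)⟫ +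
            ν * ⟪u τ x, Δ η x⟫ + p τ x * VectorCalculus.divergence η x)| := by
          simpa only [← Real.norm_eq_abs] using MeasureTheory.norm_integral_le_integral_norm _
      _ ≤ ∫ τ in Ioc s t, (A + 3 * K₁ * ∫ x in (Ω : Set (EuclideanSpace ℝ (Fin 3))), |p τ x|) := by
          refine integral_mono_ae (hFi.mono_set hsub_st).abs
            ((integrable_const A).add ((hqi.mono_set hsub_st).const_mul _)) ?_
          exact ae_restrict_of_ae_restrict_of_subset hsub_st hR
      _ = A * (t - s) + 3 * K₁ * ∫ τ in Ioc s t, ∫ x in (Ω : Set (EuclideanSpace ℝ (Fin 3))), |p τ x| := by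
          rw [integral_add (integrable_const A) ((hqi.mono_set hsub_st).const_mul _),
            MeasureTheory.integral_const, measureReal_restrict_apply_univ,
            Real.volume_real_Ioc_of_le hst, smul_eq_mul, MeasureTheory.integral_const_mul,
            mul_comm (t - s) A]
      _ ≤ A * (t - s) + 3 * K₁ * ((t - s) ^ (1 / 3 : ℝ) * B) :=
          add_le_add le_rfl (mul_le_mul_of_nonneg_left
            (NSCylinder.setIntegral_pressureSlice_le hbΩ hpm hpi hCp hP hs.1 hst ht.2)
            (mul_nonneg (by norm_num) hK₁0))
      _ = A * (t - s) + 3 * K₁ * B * (t - s) ^ (1 / 3 : ℝ) := by ring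
  rintro t ⟨ht, htc⟩ s ⟨hs, hsc⟩
  rw [htc, hsc, add_sub_add_left_eq_sub]
  rcases le_total s t with hst | hts
  · have e : |t - s| = t - s := abs_of_nonneg (sub_nonneg.2 hst)
    rw [e]
    exact key t ht s hs hst
  · have e : |t - s| = s - t := by rw [abs_sub_comm]; exact abs_of_nonneg (sub_nonneg.2 hts)
    rw [e, abs_sub_comm]
    exact key s hs t ht hts

end Modulus

end Summit.NavierStokesRegularity.NavierStokesRegularity.Theorems.SereginZoomReduction
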